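import Mathlib.GroupTheory.Perm.Fin
import Literature.AnabelianGeometry.AbsoluteAnabelian.TPairs
import Literature.AnabelianGeometry.AbsoluteAnabelian.GaloisTheatersTrivialContext
import HarnessLib

/-!
# [AbsTopIII] Cor 5.2 (ii) and Rmk 5.2.3 (cyclotome isomorphism of a global `T`-pair): the universal
# closures of the interface typings are FALSE, and model-witnessed — FACT-LIST rows F-0186, F-0187

S. Mochizuki, *Topics in absolute anabelian geometry III: global reconstruction algorithms*, J. Math.
Sci. Univ. Tokyo 22 (2015) [MochizukiAbsTopIII2015], Cor 5.2 (ii) p. 119 ("there is a unique isomorphism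
`μ_Ẑ(M⊚_TM) ≅ μ_Ẑ(Π)` that is compatible, relative to the `ρ_v`, with the isomorphisms
`μ_Ẑ((M_v)_TM) ≅ μ_Ẑ(Π_v)` of Cor 1.10 (c), Rmk 3.2.1") and Rmk 5.2.3 pp. 121–122 (the `T = TLG` variant
via the archimedean primes).  Proof-only companion to `TPairs.lean` (abc-iut-L4-t3), where both are typed
as PREDICATES on an abstract `TPairVocabulary R T` — an interface whose compatibility predicates
`IsCyclotomeCompatible` / `IsCyclotomeArchCompatible` and cyclotomes `μ_Ẑ(−)` are UNINTERPRETED fields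
("named fact … an assumption on `(R, W)` true for the genuine context", loc. cit.):

* `CyclotomeIsoUnique W hT` (FACT-LIST F-0186, `T ≠ TLG`): `∀ P, ∃! ι, W.IsCyclotomeCompatible P.act ι`;
* `CyclotomeIsoViaArchimedean W hT` (F-0187, `T = TLG`): `∀ P, V̄^arc ≠ ∅ → ∃ ι, W.IsCyclotomeArchCompatible P.act ι`.

abc-iut cell, block F (fact-proving wave), plan header rule R1 (ii) (abc-iut-plan 2026-08-26T05:41:23Z):
a PARAMETRISED row whose universal closure is false gets the kernel refutation `not_forall_<decl>` (the
FACT-LIST render then marks it «universal-closure REFUTED / schema; instance forms open or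
model-witnessed») plus the instance forms.  Neither predicate has a consumer-as-hypothesis in the
[IUTchIII] Cor 3.12 cone (abc-iut-w5-d231 census v3).  This file records, sorry-free:

1. `not_forall_cyclotomeIsoUnique` (F-0186) — at the TRIVIAL-GROUP context of
   `GlobalAnabelianContext.exists_trivialGroupContext` (abc-iut-w5-d058; `Ob(EA⊚) = {Π = 1}`), the canonical
   global `TF`-pair of a junk vocabulary whose compatibility predicate is `⊥` has NO compatible cyclotome
   isomorphism (existence fails); and `exists_vocabulary_compatTop_not_cyclotomeIsoUnique` — with the
   compatibility predicate `⊤` and cyclotomes the finite discrete group `𝔖₃`, the identity and an inner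
   automorphism are two compatible isomorphisms (uniqueness fails): the row's truth value is carried
   entirely by the uninterpreted fields;
2. `GlobalAnabelianContext.exists_oneArcContext` — a context WITH an archimedean element (needed because
   Rmk 5.2.3 is vacuous on theaters without archimedean primes): `Ob(EA⊚) := {Π = 1}`, `k_NF := ℚ` (trivial
   action), `V⊚(Π) := {⊚, v_arc}` (trivial action), `X(Π, v_arc)` the one-point orbispace with `A_X := ℚ` and
   `π₁^∧ := Δ` itself (`FundamentalExtension.geomGrp`), `δ_{ell,v} := id`, `κ_{ell,v} := id`; then
   `not_forall_cyclotomeIsoViaArchimedean` (F-0187): over it, the canonical global `TLG`-pair of a junk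
   vocabulary with archimedean compatibility `⊥` has an archimedean element and no compatible isomorphism;
3. `exists_vocabulary_cyclotomeIso_facts` — over EVERY context and every `T`, the DEGENERATE vocabulary
   (all predicates `⊤`, cyclotomes the trivial profinite group; abc-iut-w5-d058's
   `TPairVocabulary.nonempty_degenerate`) satisfies BOTH named facts (model witness; joint satisfiability
   of the two rows, nothing about `μ_Ẑ`).

The INTENDED instance — `T ∈ {TF, TM, TLG}` of Def 3.1 (i), the MLF-Galois / Aut-holomorphic `T`-pairs and
the cyclotomic rigidity isomorphisms of [AbsTopIII] Cor 1.10 (c) / Rmk 3.2.1 over the étale `π₁` of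
hyperbolic orbicurves — is not constructible in the tree (abc-iut FOUNDATIONS row 12); there Cor 5.2 (ii)
is Mochizuki's corollary and stays a NAMED FACT at that instance.  HONEST FRAMING: statements about the
cell's own interface typing (DEGENERATE / junk models); nothing of [AbsTopIII] is asserted or denied;
instantiated ≠ endorsed; nothing here bears on [IUTchIII] Cor 3.12.
-/

universe u

namespace Literature.AnabelianGeometry.AbsoluteAnabelian

open CategoryTheory Topology

/-! ### F-0186: `CyclotomeIsoUnique` — existence fails for compatibility `⊥`, uniqueness fails for `⊤` -/

/-- **FACT-LIST F-0186 — the universal closure of `CyclotomeIsoUnique` is FALSE.**  At the trivial-group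
context (`Ob(EA⊚) = {Π = 1}`, one-point pro-sets) take the vocabulary with `T = T⊚ := Type`, all data
`PUnit`, all pair-predicates `⊤`, cyclotomes the trivial profinite group and `IsCyclotomeCompatible := ⊥`;
the canonical global `TF`-pair `M⊚_TF(Π)` of the point `Π = G = 1` (Cor 5.2 (iv) object, reference
isomorphisms identities) exists, and admits no compatible `μ_Ẑ(M⊚_TM) ≅ μ_Ẑ(Π)`.  Junk model of an
axiom-free interface; not a statement about Cor 5.2 (ii). [cite: MochizukiAbsTopIII2015, Cor 5.2 (ii) p. 119] -/
theorem not_forall_cyclotomeIsoUnique :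
    ¬ ∀ (R : GlobalAnabelianContext.{u}) (T : TKind) (W : TPairVocabulary R T) (hT : T ≠ TKind.TLG),
      Literature.AnabelianGeometry.AbsoluteAnabelian.CyclotomeIsoUnique W hT := by
  intro h
  obtain ⟨R, hadm, -, -, -⟩ := GlobalAnabelianContext.exists_trivialGroupContext.{u}
  let E₁ : FundamentalExtension.{u} :=
    { arith := ProfiniteGrp.of PUnit.{u + 1}, gal := ProfiniteGrp.of PUnit.{u + 1},
      aug := ContinuousMonoidHom.id _, aug_surjective := Function.surjective_id }
  have hE₁ : R.IsAdmissible E₁ := (hadm E₁).mpr (inferInstanceAs (Subsingleton PUnit))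
  let W : TPairVocabulary R TKind.TF :=
    { LocObj := Type u
      GlobObj := Type u
      toGlob := 𝟭 (Type u)
      IsContLoc := fun _ => True
      IsContGlob := fun _ => True
      IsMLFGaloisPair := fun _ => True
      KummerStr := fun _ _ => PUnit.{u + 1}
      IsAutHolPair := fun _ => True
      kummerTransport := fun _ _ _ => PUnit.unit
      kummerTransport_refl := fun _ => rfl
      globData := fun _ => PUnit.{u + 1}
      globAct := fun _ => 1
      locDataNon := fun _ _ => PUnit.{u + 1}
      locDataArc := fun _ _ => PUnit.{u + 1}
      locAct := fun _ _ => 1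
      locKummer := fun _ _ => PUnit.unit
      locRestrictNon := fun _ _ => 𝟙 _
      locRestrictArc := fun _ _ => 𝟙 _
      cyclotome := fun _ => ProfiniteGrp.of PUnit.{u + 1}
      cyclotomeGrp := fun _ => ProfiniteGrp.of PUnit.{u + 1}
      IsCyclotomeCompatible := fun _ _ => False
      IsCyclotomeArchCompatible := fun _ _ => True
      ZIndex := PEmpty.{u + 1}
      IsGeomIsoTo := fun z _ => z.elim }
  obtain ⟨ι, hι, -⟩ :=
    h R TKind.TF W TKind.noConfusion (W.canonical E₁ hE₁ trivial (fun _ => trivial) (fun _ => trivial))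
  exact hι

/-- **F-0186, uniqueness half fails as well** (universe `0`): at the trivial-group context, the vocabulary
with compatibility predicate `⊤` and cyclotomes the finite discrete group `𝔖₃ = Perm(Fin 3)` has a global
`TF`-pair (the canonical one of `Π = 1`) with TWO distinct compatible cyclotome isomorphisms — the identity
and conjugation by the transposition `(0 1)` (which moves `(1 2)`).  Together with
`not_forall_cyclotomeIsoUnique`: the row's truth value is carried entirely by the uninterpreted fields
`IsCyclotomeCompatible`, `cyclotome`, `cyclotomeGrp`. [cite: MochizukiAbsTopIII2015, Cor 5.2 (ii) p. 119] -/
theorem exists_vocabulary_compatTop_not_cyclotomeIsoUnique :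
    ∃ (R : GlobalAnabelianContext.{0}) (W : TPairVocabulary R TKind.TF),
      (∀ {E : FundamentalExtension.{0}} {M : W.GlobObj} (act : E.arith →* Aut M)
          (ι : W.cyclotome M ≃ₜ* W.cyclotomeGrp E), W.IsCyclotomeCompatible act ι) ∧
      ¬ CyclotomeIsoUnique W TKind.noConfusion := by
  obtain ⟨R, hadm, -, -, -⟩ := GlobalAnabelianContext.exists_trivialGroupContext.{0}
  let E₁ : FundamentalExtension.{0} :=
    { arith := ProfiniteGrp.of PUnit.{1}, gal := ProfiniteGrp.of PUnit.{1},
      aug := ContinuousMonoidHom.id _, aug_surjective := Function.surjective_id }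
  have hE₁ : R.IsAdmissible E₁ := (hadm E₁).mpr (inferInstanceAs (Subsingleton PUnit))
  let C : ProfiniteGrp.{0} := ProfiniteGrp.ofFiniteGrp (FiniteGrp.of (Equiv.Perm (Fin 3)))
  haveI : DiscreteTopology C := ⟨rfl⟩
  let W : TPairVocabulary R TKind.TF :=
    { LocObj := Type
      GlobObj := Type
      toGlob := 𝟭 Type
      IsContLoc := fun _ => True
      IsContGlob := fun _ => True
      IsMLFGaloisPair := fun _ => True
      KummerStr := fun _ _ => PUnit.{1}
      IsAutHolPair := fun _ => True
      kummerTransport := fun _ _ _ => PUnit.unit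
      kummerTransport_refl := fun _ => rfl
      globData := fun _ => PUnit.{1}
      globAct := fun _ => 1
      locDataNon := fun _ _ => PUnit.{1}
      locDataArc := fun _ _ => PUnit.{1}
      locAct := fun _ _ => 1
      locKummer := fun _ _ => PUnit.unit
      locRestrictNon := fun _ _ => 𝟙 _
      locRestrictArc := fun _ _ => 𝟙 _
      cyclotome := fun _ => C
      cyclotomeGrp := fun _ => C
      IsCyclotomeCompatible := fun _ _ => True
      IsCyclotomeArchCompatible := fun _ _ => True
      ZIndex := PEmpty.{1}
      IsGeomIsoTo := fun z _ => z.elim }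
  refine ⟨R, W, fun _ _ => trivial, fun h => ?_⟩
  -- two compatible isomorphisms `C ≃ₜ* C`: the identity and conjugation by `(0 1)`
  let g : C := (Equiv.swap (0 : Fin 3) 1 : Equiv.Perm (Fin 3))
  let x : C := (Equiv.swap (1 : Fin 3) 2 : Equiv.Perm (Fin 3))
  let σ : C ≃ₜ* C :=
    { (MulAut.conj g : C ≃* C) with
      continuous_toFun := continuous_of_discreteTopology
      continuous_invFun := continuous_of_discreteTopology }
  obtain ⟨ι, -, huniq⟩ := h (W.canonical E₁ hE₁ trivial (fun _ => trivial) (fun _ => trivial))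
  have h₁ : ContinuousMulEquiv.refl C = ι := huniq _ trivial
  have h₂ : σ = ι := huniq _ trivial
  have hx : σ x = x := by rw [h₂, ← h₁]; rfl
  have hx' : g * x * g⁻¹ = x := hx
  have key : (Equiv.swap (0 : Fin 3) 1 : Equiv.Perm (Fin 3)) * Equiv.swap (1 : Fin 3) 2 *
      (Equiv.swap (0 : Fin 3) 1)⁻¹ ≠ Equiv.swap (1 : Fin 3) 2 := by decide
  exact key hx'

/-! ### A context with an archimedean element, and F-0187: `CyclotomeIsoViaArchimedean` -/

/-- **A trivial-group context WITH ONE ARCHIMEDEAN ELEMENT** (universe `0`; DEGENERATE — no hyperbolic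
orbicurve has `Π = 1`): `Ob(EA⊚) := {Π ↠ G : Π = 1}` (for which `Δ = 1` IS the maximal topologically
finitely generated closed normal subgroup), `k_NF(Π) := ℚ` with the trivial action, `V⊚(Π) := {⊚, v}` with
`V⊚(Π)^arc = {v}`, `V⊚(Π)^non = ∅`, trivial (continuous) action; `X(Π, v)` the one-point Aut-holomorphic
orbispace stub with `A_X := ℚ` and `π₁(X)^∧ := Δ` (so that `δ_{ell,v} : Δ ≅ π₁^∧` is the identity for EVERY
`Π ↠ G`), `κ_{ell,v} := id_ℚ`; `V⊚(f) := id`, `k_NF(f) := id`.  Every law of the record holds.  Purpose: a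
theater over it HAS an archimedean element, so Rmk 5.2.3-type statements are not vacuous there.
[cite: MochizukiAbsTopIII2015, Def 5.1 (ii) p. 114] -/
theorem GlobalAnabelianContext.exists_oneArcContext :
    ∃ R : GlobalAnabelianContext.{0}, (∀ E, R.IsAdmissible E ↔ Subsingleton E.arith) ∧
      (∀ E, ((R.proVal E).arc).Nonempty) ∧ (∀ E v, v ∉ (R.proVal E).non) := by
  let V : ∀ E : FundamentalExtension.{0}, GaloisProSet E.arith := fun E =>
    { carrier := Bool
      action := { smul := fun _ b => b, one_smul := fun _ => rfl, mul_smul := fun _ _ _ => rfl }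
      continuousSMul := @ContinuousSMul.mk _ _ (_) _ _ continuous_snd
      generic := false
      non := ∅
      arc := {true}
      smul_generic := fun _ => rfl
      generic_notMem_non := fun h => h
      generic_notMem_arc := fun h => Bool.false_ne_true h
      disjoint_non_arc := disjoint_bot_left
      eq_generic_or_mem := fun v => by
        cases v
        · exact Or.inl rfl
        · exact Or.inr (Or.inr rfl)
      smul_mem_non := fun _ _ h => h
      smul_mem_arc := fun _ _ h => h }
  let X : FundamentalExtension.{0} → AutHolOrbispace.{0} := fun E =>
    { carrier := PUnit.{1}, fieldA := ℚ, pi1Hat := E.geomGrp }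
  have hiso : ∀ {E₁ E₂ : FundamentalExtension.{0}}, Nonempty (E₁ ≅ E₂) →
      Subsingleton E₁.arith → Subsingleton E₂.arith := by
    rintro E₁ E₂ ⟨e⟩ h
    refine ⟨fun a b => ?_⟩
    have ha : (e.inv ≫ e.hom).arith a = a := by rw [e.inv_hom_id]; rfl
    have hb : (e.inv ≫ e.hom).arith b = b := by rw [e.inv_hom_id]; rfl
    rw [← ha, ← hb, FundamentalExtension.comp_arith]
    exact congrArg e.hom.arith (Subsingleton.elim _ _)
  have hmax : ∀ E : FundamentalExtension.{0}, Subsingleton E.arith → IsMaxTopFGClosedNormal E.geom := by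
    intro E hE
    exact
      { normal := inferInstanceAs E.aug.toMonoidHom.ker.Normal
        isClosed := E.isClosed_geom
        topFG := ⟨∅, eq_top_iff.mpr fun x _ => by rw [Subsingleton.elim x 1]; exact one_mem _⟩
        maximal := fun N _ _ _ x _ => by rw [Subsingleton.elim x 1]; exact one_mem _ }
  refine
    ⟨{ IsAdmissible := fun E => Subsingleton E.arith
       isAdmissible_of_iso := hiso
       geom_isMax := hmax
       kNF := fun _ => ℚ
       instField := fun _ => inferInstance
       instAction := fun E => MulSemiringAction.compHom _ (1 : E.arith →* (ℚ →+* ℚ))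
       proVal := V
       archSpace := fun E _ => X E
       δell := fun E _ => ContinuousMulEquiv.refl _
       κell := fun _ _ => RingHom.id ℚ
       mapProVal := fun _ _ => Homeomorph.refl _
       mapProVal_smul := fun _ _ _ _ => rfl
       mapKNF := fun _ _ => RingEquiv.refl _ },
      fun _ => Iff.rfl, fun _ => ⟨true, rfl⟩, fun _ _ h => h⟩

/-- **FACT-LIST F-0187 — the universal closure of `CyclotomeIsoViaArchimedean` is FALSE** (universe `0`).
Over the one-arc context of `GlobalAnabelianContext.exists_oneArcContext`, take the `TLG`-vocabulary with
all data `PUnit`, all pair-predicates `⊤`, trivial cyclotomes and `IsCyclotomeArchCompatible := ⊥`; the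
canonical global `TLG`-pair of the point `Π = G = 1` has an archimedean element in `V̄^arc` and admits no
archimedean-compatible cyclotome isomorphism.  Junk model of an axiom-free interface; not a statement
about Rmk 5.2.3. [cite: MochizukiAbsTopIII2015, Rmk 5.2.3 pp. 121–122] -/
theorem not_forall_cyclotomeIsoViaArchimedean :
    ¬ ∀ (R : GlobalAnabelianContext.{0}) (T : TKind) (W : TPairVocabulary R T) (hT : T = TKind.TLG),
      Literature.AnabelianGeometry.AbsoluteAnabelian.CyclotomeIsoViaArchimedean W hT := by
  intro h
  obtain ⟨R, hadm, harc, -⟩ := GlobalAnabelianContext.exists_oneArcContext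
  let E₁ : FundamentalExtension.{0} :=
    { arith := ProfiniteGrp.of PUnit.{1}, gal := ProfiniteGrp.of PUnit.{1},
      aug := ContinuousMonoidHom.id _, aug_surjective := Function.surjective_id }
  have hE₁ : R.IsAdmissible E₁ := (hadm E₁).mpr (inferInstanceAs (Subsingleton PUnit))
  let W : TPairVocabulary R TKind.TLG :=
    { LocObj := Type
      GlobObj := Type
      toGlob := 𝟭 Type
      IsContLoc := fun _ => True
      IsContGlob := fun _ => True
      IsMLFGaloisPair := fun _ => True
      KummerStr := fun _ _ => PUnit.{1}
      IsAutHolPair := fun _ => True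
      kummerTransport := fun _ _ _ => PUnit.unit
      kummerTransport_refl := fun _ => rfl
      globData := fun _ => PUnit.{1}
      globAct := fun _ => 1
      locDataNon := fun _ _ => PUnit.{1}
      locDataArc := fun _ _ => PUnit.{1}
      locAct := fun _ _ => 1
      locKummer := fun _ _ => PUnit.unit
      locRestrictNon := fun _ _ => 𝟙 _
      locRestrictArc := fun _ _ => 𝟙 _
      cyclotome := fun _ => ProfiniteGrp.of PUnit.{1}
      cyclotomeGrp := fun _ => ProfiniteGrp.of PUnit.{1}
      IsCyclotomeCompatible := fun _ _ => True
      IsCyclotomeArchCompatible := fun _ _ => False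
      ZIndex := PEmpty.{1}
      IsGeomIsoTo := fun z _ => z.elim }
  obtain ⟨ι, hι⟩ :=
    h R TKind.TLG W rfl (W.canonical E₁ hE₁ trivial (fun _ => trivial) (fun _ => trivial)) (harc E₁)
  exact hι

/-! ### Model witness: both facts hold for the degenerate vocabulary over every context -/

/-- **Joint satisfiability (DEGENERATE model witness) of `CyclotomeIsoUnique` and
`CyclotomeIsoViaArchimedean`.**  Over EVERY context `R` and for every `T`, the degenerate vocabulary
(`T = T⊚ := Type u`, all data `PUnit`, all predicates `⊤`, cyclotomes the trivial profinite group — cf.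
`TPairVocabulary.nonempty_degenerate`) satisfies both named facts: the only isomorphism `1 ≅ 1` is the
identity and it is compatible.  Label DEGENERATE; instantiated ≠ endorsed.
[cite: MochizukiAbsTopIII2015, Cor 5.2 (ii) p. 119] -/
theorem exists_vocabulary_cyclotomeIso_facts (R : GlobalAnabelianContext.{u}) (T : TKind) :
    ∃ W : TPairVocabulary R T,
      (∀ hT : T ≠ TKind.TLG, CyclotomeIsoUnique W hT) ∧
      (∀ hT : T = TKind.TLG, CyclotomeIsoViaArchimedean W hT) := by
  haveI : Subsingleton (ProfiniteGrp.of PUnit.{u + 1}) := inferInstanceAs (Subsingleton PUnit)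
  refine
    ⟨{ LocObj := Type u
       GlobObj := Type u
       toGlob := 𝟭 (Type u)
       IsContLoc := fun _ => True
       IsContGlob := fun _ => True
       IsMLFGaloisPair := fun _ => True
       KummerStr := fun _ _ => PUnit.{u + 1}
       IsAutHolPair := fun _ => True
       kummerTransport := fun _ _ _ => PUnit.unit
       kummerTransport_refl := fun _ => rfl
       globData := fun _ => PUnit.{u + 1}
       globAct := fun _ => 1
       locDataNon := fun _ _ => PUnit.{u + 1}
       locDataArc := fun _ _ => PUnit.{u + 1}
       locAct := fun _ _ => 1
       locKummer := fun _ _ => PUnit.unit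
       locRestrictNon := fun _ _ => 𝟙 _
       locRestrictArc := fun _ _ => 𝟙 _
       cyclotome := fun _ => ProfiniteGrp.of PUnit.{u + 1}
       cyclotomeGrp := fun _ => ProfiniteGrp.of PUnit.{u + 1}
       IsCyclotomeCompatible := fun _ _ => True
       IsCyclotomeArchCompatible := fun _ _ => True
       ZIndex := PEmpty.{u + 1}
       IsGeomIsoTo := fun z _ => z.elim }, fun _ P => ?_, fun _ P _ => ⟨ContinuousMulEquiv.refl _, trivial⟩⟩
  exact ⟨ContinuousMulEquiv.refl _, trivial, fun ι _ =>
    ContinuousMulEquiv.ext fun x => Subsingleton.elim _ _⟩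

end Literature.AnabelianGeometry.AbsoluteAnabelian
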